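import Literature.Geometry.Kaehler.HolomorphicLineBundleCech
import HarnessLib

/-!
# Multiplication by a section: the cochain maps `C^•(𝔙, 𝒪(L)) → C^•(𝔙, 𝒪(L'))`

Layer `Literature/Geometry/Kaehler`, companion of `HolomorphicLineBundleCech` (the Čech complex
`C^•(𝔙, 𝒪(L))` of a cocycle line bundle `L` on a framed cover `𝔙 = (V_k, frame k)`, sections over
`V_J` read in the frame of the first index). For two cocycle line bundles `L`, `L'` on the same
indexing of frames, a **holomorphic section `t` of `Hom(L, L') = L⁻¹ ⊗ L'`** is a family of
holomorphic functions `t_i` on `U_i ∩ U'_i` with `g'_ij t_i = t_j g_ij` (`HomSection`); multiplying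
coordinates framewise, `s_i ↦ t_i s_i`, maps sections of `L` to sections of `L'` — for
`L' = L ⊗ 𝒪(H)` and `t` the canonical section of `𝒪(H)` this is the first arrow of Serre's exact
sequence `0 → 𝒪(L) → 𝒪(L ⊗ 𝒪(H)) → 𝒪_H(L ⊗ 𝒪(H)) → 0` of a hyperplane section (J.-P. Serre,
*Faisceaux algébriques cohérents* (1955), n° 81; *GAGA* (1956), n° 16 Lemme 8; Griffiths–Harris,
p. 139, "multiplication by `s_D`"). We set up, for a framed cover `𝔙` of `L` whose members are small
for `L'` too:

* `FramedCover.transfer` — the same cover `(V_k, frame k)` as a framed cover of `L'`; its cochain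
  groups are those of `𝔙` (definitionally), only the differential changes;
* `FramedCover.mulCochain t` — **the cochain map "multiplication by `t`"**,
  `(t c)_J = t_{frame J₀} c_J` on `V_J`, commuting with the two differentials (`delta_mulCochain`:
  the intertwining `g'_{pq} t_p = t_q g_{pq}` of the changes of frame);
* `mulCochain_injective` — it is **injective in every degree as soon as `{t ≠ 0}` is dense** in the
  members (identity principle in its weakest, continuity, form), the exactness on the left of Serre's
  sequence on cochains;
* `mulCochain_mulCochain_comm` — two such multiplications through different intermediate bundles with
  the same product of coordinates agree (`t' (t c) = t (t' c)`), the commuting square of the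
  `9`-diagram of two hyperplane sections.

The cohomological consequences (long exact sequences of the cokernel complexes, six-term
inequalities) are the business of `Literature.Algebra.Homology.NatCochainCokernelSequence` /
`NatCochainSixTerm`. Everything here is proved; the definitions are `HomSection`, `transfer`,
`mulCochain`.

## References

* J.-P. Serre, *Faisceaux algébriques cohérents*, Ann. of Math. 61 (1955), n° 81. [SerreFAC1955]
* J.-P. Serre, *Géométrie algébrique et géométrie analytique*, Ann. Inst. Fourier 6 (1956), n° 16
  Lemme 8. [SerreGAGA1956]
* P. Griffiths, J. Harris, *Principles of Algebraic Geometry* (1978), pp. 34–35, 139.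
  [GriffithsHarris1978]
-/

noncomputable section

open scoped Manifold ContDiff Topology
open Set Filter Function Literature.Algebra.Homology

namespace Literature.Geometry.Kaehler

namespace HolomorphicLineBundle

variable {ι κ : Type*} {E : Type*} [NormedAddCommGroup E] [NormedSpace ℂ E]
  {M : Type*} [TopologicalSpace M] [ChartedSpace E M]

/-! ### Sections of `Hom(L, L')` -/

/-- **A holomorphic section of `Hom(L, L') = L⁻¹ ⊗ L'`** for two cocycle line bundles on the same
indexing of frames: holomorphic functions `t_i` on `U_i ∩ U'_i` (the matrix of the morphism in the
frames `σ_i`, `σ'_i`) with `g'_ij t_i = t_j g_ij` on the overlaps, so that `s_i ↦ t_i s_i` maps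
sections of `L` (`s_j = g_ij s_i`) to sections of `L'`. For `L' = L ⊗ 𝒪(D)` these are the sections
of `𝒪(D)`, acting by multiplication (Griffiths–Harris p. 139). Values of `t_i` off `U_i ∩ U'_i` are
junk. [cite: GriffithsHarris1978, pp. 66–67 and p. 139] -/
structure HomSection (L L' : HolomorphicLineBundle ι E M) where
  /-- The coordinate `t_i` of the section in the frames `σ_i`, `σ'_i`. -/
  coord : ι → M → ℂ
  /-- `t_i` is holomorphic on `U_i ∩ U'_i`. -/
  mdifferentiableOn_coord :
    ∀ i, MDifferentiableOn 𝓘(ℂ, E) 𝓘(ℂ, ℂ) (coord i) (L.baseSet i ∩ L'.baseSet i)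
  /-- The intertwining relation `g'_ij t_i = t_j g_ij` on `U_i ∩ U_j ∩ U'_i ∩ U'_j`. -/
  coordChange_mul_coord : ∀ i j, ∀ x ∈ (L.baseSet i ∩ L.baseSet j) ∩ (L'.baseSet i ∩ L'.baseSet j),
    L'.coordChange i j x * coord i x = coord j x * L.coordChange i j x

namespace FramedCover

variable {L L' L'' K : HolomorphicLineBundle ι E M} (C : L.FramedCover κ)

/-! ### The same cover for a second bundle -/

/-- **The same framed cover `(V_k, frame k)` for a second bundle `L'`** on the same indexing of
frames, when every `V_k` is also contained in `U'_{frame k}`. Its cochain groups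
`C^a(𝔙, 𝒪(L'))` are those of `𝔙` — the same holomorphic functions on the same `V_J` —, only the
changes of frame in the differential are those of `L'`. [cite: SerreFAC1955, n° 81] -/
def transfer (L' : HolomorphicLineBundle ι E M) (h : ∀ k, C.U k ⊆ L'.baseSet (C.frame k)) :
    L'.FramedCover κ where
  U := C.U
  isOpen := C.isOpen
  frame := C.frame
  subset := h

/-- The members of the transferred cover (definitional). [folklore] -/
@[simp]
theorem transfer_U (L' : HolomorphicLineBundle ι E M) (h : ∀ k, C.U k ⊆ L'.baseSet (C.frame k)) :
    (C.transfer L' h).U = C.U :=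
  rfl

/-- The frames of the transferred cover (definitional). [folklore] -/
@[simp]
theorem transfer_frame (L' : HolomorphicLineBundle ι E M) (h : ∀ k, C.U k ⊆ L'.baseSet (C.frame k)) :
    (C.transfer L' h).frame = C.frame :=
  rfl

/-! ### Multiplication by a section of `Hom(L, L')` on cochains -/

section Mul

/-- The coordinate `t_{frame J₀}` is holomorphic on `V_J`. [folklore] -/
theorem mdifferentiableOn_coord_cechSet (t : HomSection L L') (h : ∀ k, C.U k ⊆ L'.baseSet (C.frame k))
    {a : ℕ} (J : Fin (a + 1) → κ) :
    MDifferentiableOn 𝓘(ℂ, E) 𝓘(ℂ, ℂ) (t.coord (C.frame (J 0))) (cechSet C.U J) :=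
  (t.mdifferentiableOn_coord _).mono fun _ hx ↦
    ⟨C.subset _ (cechSet_subset_apply C.U J 0 hx), h _ (cechSet_subset_apply C.U J 0 hx)⟩

/-- **Multiplication by `t` on cochains**, `(t c)_J = t_{frame J₀} · c_J` on `V_J`: the cochain map
`C^a(𝔙, 𝒪(L)) → C^a(𝔙, 𝒪(L'))` induced by the sheaf map `s ↦ t s` (Serre's `𝒪(L) → 𝒪(L ⊗ 𝒪(H))`).
[cite: SerreFAC1955, n° 81] [cite: SerreGAGA1956, n° 16 (proof of Lemme 8)] -/
def mulCochain (t : HomSection L L') (h : ∀ k, C.U k ⊆ L'.baseSet (C.frame k)) (a : ℕ) :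
    C.Cochain a →ₗ[ℂ] (C.transfer L' h).Cochain a where
  toFun c J := holFunOn.mulRestrict (subset_refl (cechSet C.U J))
    (C.mdifferentiableOn_coord_cechSet t h J) (c J)
  map_add' c c' := by
    funext J
    change holFunOn.mulRestrict _ (C.mdifferentiableOn_coord_cechSet t h J) ((c + c') J) =
      holFunOn.mulRestrict _ (C.mdifferentiableOn_coord_cechSet t h J) (c J) +
        holFunOn.mulRestrict _ (C.mdifferentiableOn_coord_cechSet t h J) (c' J)
    rw [Pi.add_apply, map_add]
  map_smul' r c := by
    funext J
    change holFunOn.mulRestrict _ (C.mdifferentiableOn_coord_cechSet t h J) ((r • c) J) =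
      r • holFunOn.mulRestrict _ (C.mdifferentiableOn_coord_cechSet t h J) (c J)
    rw [Pi.smul_apply, map_smul]

/-- Multiplication by `t` at a point of `V_J`. [folklore] -/
theorem mulCochain_apply_apply_of_mem (t : HomSection L L') (h : ∀ k, C.U k ⊆ L'.baseSet (C.frame k))
    {a : ℕ} (c : C.Cochain a) {J : Fin (a + 1) → κ} {x : M}
    (hx : x ∈ cechSet C.U J) :
    (C.mulCochain t h a c J : M → ℂ) x = t.coord (C.frame (J 0)) x * (c J : M → ℂ) x :=
  holFunOn.mulRestrict_apply_of_mem (subset_refl _) (C.mdifferentiableOn_coord_cechSet t h J) (c J) hx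

/-- Multiplication by `t` off `V_J`. [folklore] -/
theorem mulCochain_apply_apply_of_notMem (t : HomSection L L') (h : ∀ k, C.U k ⊆ L'.baseSet (C.frame k))
    {a : ℕ} (c : C.Cochain a) {J : Fin (a + 1) → κ} {x : M}
    (hx : x ∉ cechSet C.U J) : (C.mulCochain t h a c J : M → ℂ) x = 0 :=
  holFunOn.mulRestrict_apply_of_notMem (subset_refl _) (C.mdifferentiableOn_coord_cechSet t h J) (c J) hx

/-- The changes of frame of `L` and `L'` along a face are intertwined by `t`:
`g'_{J, τ} t_{frame J(τ 0)} = t_{frame J₀} g_{J, τ}` on `V_J`. [folklore] -/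
theorem trans_mul_coord (t : HomSection L L') (h : ∀ k, C.U k ⊆ L'.baseSet (C.frame k))
    {m n : ℕ} (J : Fin (n + 1) → κ) (τ : Fin (m + 1) → Fin (n + 1)) {x : M}
    (hx : x ∈ cechSet C.U J) :
    (C.transfer L' h).trans J τ x * t.coord (C.frame (J (τ 0))) x =
      t.coord (C.frame (J 0)) x * C.trans J τ x := by
  have hp := cechSet_subset_apply C.U J (τ 0) hx
  have hq := cechSet_subset_apply C.U J 0 hx
  exact t.coordChange_mul_coord _ _ x ⟨⟨C.subset _ hp, C.subset _ hq⟩, h _ hp, h _ hq⟩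

/-- **Multiplication by `t` is a cochain map**: `δ' (t c) = t (δ c)`.
[cite: SerreFAC1955, n° 81] -/
theorem delta_mulCochain (t : HomSection L L') (h : ∀ k, C.U k ⊆ L'.baseSet (C.frame k)) (a : ℕ)
    (c : C.Cochain a) :
    (C.transfer L' h).delta a (C.mulCochain t h a c) = C.mulCochain t h (a + 1) (C.delta a c) := by
  funext J
  refine Subtype.ext (funext fun x ↦ ?_)
  by_cases hx : x ∈ cechSet C.U J
  · rw [C.mulCochain_apply_apply_of_mem t h _ hx, C.delta_apply_apply_of_mem c hx,
      (C.transfer L' h).delta_apply_apply_of_mem _ hx, Finset.mul_sum]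
    refine Finset.sum_congr rfl fun j _ ↦ ?_
    have hxj : x ∈ cechSet C.U (J ∘ Fin.succAbove j) := cechSet_subset_comp C.U J _ hx
    rw [show ((C.mulCochain t h a c (J ∘ Fin.succAbove j) : ↥(holFunOn E _)) : M → ℂ) x =
        t.coord (C.frame (J (Fin.succAbove j 0))) x * (c (J ∘ Fin.succAbove j) : M → ℂ) x from
      C.mulCochain_apply_apply_of_mem t h c hxj]
    have key := C.trans_mul_coord t h J (Fin.succAbove j) hx
    calc (-1 : ℂ) ^ (j : ℕ) * ((C.transfer L' h).trans J (Fin.succAbove j) x *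
          (t.coord (C.frame (J (Fin.succAbove j 0))) x * (c (J ∘ Fin.succAbove j) : M → ℂ) x))
        = (-1 : ℂ) ^ (j : ℕ) * ((C.transfer L' h).trans J (Fin.succAbove j) x *
            t.coord (C.frame (J (Fin.succAbove j 0))) x) * (c (J ∘ Fin.succAbove j) : M → ℂ) x := by
          ring
      _ = _ := by rw [key]; ring
  · rw [C.mulCochain_apply_apply_of_notMem t h _ hx]
    exact holFunOn.apply_of_notMem _ hx

/-- **Multiplication by `t` is injective on cochains when `{t ≠ 0}` is dense in the members**: a
holomorphic (indeed continuous) `c_J` with `t c_J = 0` on `V_J` vanishes on the dense open part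
`{t ≠ 0} ∩ V_J`, hence on `V_J`. This is the injectivity of `𝒪(L) → 𝒪(L ⊗ 𝒪(H))` for a section `t`
vanishing identically on no component. [cite: SerreGAGA1956, n° 16 (proof of Lemme 8)] -/
theorem mulCochain_injective (t : HomSection L L') (h : ∀ k, C.U k ⊆ L'.baseSet (C.frame k)) {a : ℕ}
    (hd : ∀ J : Fin (a + 1) → κ, cechSet C.U J ⊆ closure {x | t.coord (C.frame (J 0)) x ≠ 0}) :
    Injective (C.mulCochain t h a) := by
  refine (injective_iff_map_eq_zero _).2 fun c hc ↦ ?_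
  funext J
  refine Subtype.ext (funext fun x ↦ ?_)
  by_cases hx : x ∈ cechSet C.U J
  swap
  · exact holFunOn.apply_of_notMem _ hx
  -- `c_J` vanishes on `{t ≠ 0} ∩ V_J`
  have h0 : ∀ y ∈ cechSet C.U J ∩ {x | t.coord (C.frame (J 0)) x ≠ 0}, (c J : M → ℂ) y = 0 := by
    rintro y ⟨hy, hty⟩
    have := congr_fun (congr_arg Subtype.val (congr_fun hc J)) y
    rw [C.mulCochain_apply_apply_of_mem t h c hy] at this
    exact (mul_eq_zero.1 this).resolve_left hty
  -- and is continuous on the open `V_J`, in which that set is dense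
  have hcont : ContinuousOn (c J : M → ℂ) (cechSet C.U J) :=
    (holFunOn.mdifferentiableOn (c J)).continuousOn
  have hcl : x ∈ closure (cechSet C.U J ∩ {x | t.coord (C.frame (J 0)) x ≠ 0}) :=
    (isOpen_cechSet C.isOpen J).inter_closure ⟨hx, hd J hx⟩
  have hW : cechSet C.U J ∈ 𝓝 x := (isOpen_cechSet C.isOpen J).mem_nhds hx
  have hlim : Tendsto (c J : M → ℂ) (𝓝[cechSet C.U J ∩ {x | t.coord (C.frame (J 0)) x ≠ 0}] x)
      (𝓝 ((c J : M → ℂ) x)) :=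
    ((hcont x hx).mono_left (nhdsWithin_mono x inter_subset_left))
  have hlim0 : Tendsto (c J : M → ℂ) (𝓝[cechSet C.U J ∩ {x | t.coord (C.frame (J 0)) x ≠ 0}] x)
      (𝓝 0) :=
    tendsto_const_nhds.congr' (eventually_nhdsWithin_of_forall fun y hy ↦ (h0 y hy).symm)
  haveI : (𝓝[cechSet C.U J ∩ {x | t.coord (C.frame (J 0)) x ≠ 0}] x).NeBot :=
    mem_closure_iff_nhdsWithin_neBot.1 hcl
  exact tendsto_nhds_unique hlim hlim0

end Mul

/-! ### Two multiplications commute -/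

/-- **`t' (t c) = s' (s c)` when `t'_q t_q = s'_q s_q`**: multiplications through two intermediate
bundles with the same product of coordinates agree on cochains — in particular `t' (t c) = t (t' c)`
for two sections `t, t'` of `𝒪(H)` acting on `𝒪(L ⊗ 𝒪(mH))`, the commuting square of the
`9`-diagram of two hyperplane sections. [cite: SerreGAGA1956, n° 16 (proof of Lemme 8)] -/
theorem mulCochain_mulCochain_comm (t₁ : HomSection L L') (t₂ : HomSection L' L'')
    (s₁ : HomSection L K) (s₂ : HomSection K L'')
    (h₁ : ∀ k, C.U k ⊆ L'.baseSet (C.frame k)) (h₂ : ∀ k, C.U k ⊆ L''.baseSet (C.frame k))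
    (h₁' : ∀ k, C.U k ⊆ K.baseSet (C.frame k))
    (hts : ∀ i, ∀ x ∈ L.baseSet i, t₂.coord i x * t₁.coord i x = s₂.coord i x * s₁.coord i x)
    (a : ℕ) (c : C.Cochain a) :
    (C.transfer L' h₁).mulCochain t₂ h₂ a (C.mulCochain t₁ h₁ a c) =
      (C.transfer K h₁').mulCochain s₂ h₂ a (C.mulCochain s₁ h₁' a c) := by
  funext J
  refine Subtype.ext (funext fun x ↦ ?_)
  by_cases hx : x ∈ cechSet C.U J
  · change ((C.transfer L' h₁).mulCochain t₂ h₂ a (C.mulCochain t₁ h₁ a c) J : M → ℂ) x =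
      ((C.transfer K h₁').mulCochain s₂ h₂ a (C.mulCochain s₁ h₁' a c) J : M → ℂ) x
    rw [(C.transfer L' h₁).mulCochain_apply_apply_of_mem t₂ h₂ _ hx,
      (C.transfer K h₁').mulCochain_apply_apply_of_mem s₂ h₂ _ hx]
    change t₂.coord (C.frame (J 0)) x * (C.mulCochain t₁ h₁ a c J : M → ℂ) x =
      s₂.coord (C.frame (J 0)) x * (C.mulCochain s₁ h₁' a c J : M → ℂ) x
    rw [C.mulCochain_apply_apply_of_mem t₁ h₁ c hx, C.mulCochain_apply_apply_of_mem s₁ h₁' c hx,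
      ← mul_assoc, ← mul_assoc, hts _ x (C.subset _ (cechSet_subset_apply C.U J 0 hx))]
  · change ((C.transfer L' h₁).mulCochain t₂ h₂ a (C.mulCochain t₁ h₁ a c) J : M → ℂ) x =
      ((C.transfer K h₁').mulCochain s₂ h₂ a (C.mulCochain s₁ h₁' a c) J : M → ℂ) x
    rw [(C.transfer L' h₁).mulCochain_apply_apply_of_notMem t₂ h₂ _ hx,
      (C.transfer K h₁').mulCochain_apply_apply_of_notMem s₂ h₂ _ hx]

end FramedCover

end HolomorphicLineBundle

end Literature.Geometry.Kaehler

end
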